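import Literature.NumberTheory.PAdicHodge.TateTwistCoboundary
import Literature.NumberTheory.PAdicHodge.TateH1Cocycle
import Literature.NumberTheory.PAdicHodge.TateSenConditionCompletedAlgClosure
import Literature.NumberTheory.PAdicHodge.TateCocycleTransferContinuous
import Literature.NumberTheory.PAdicHodge.TateH1LogChiLine
import Literature.NumberTheory.PAdicHodge.TateLogCyclotomicClass
import Mathlib.Algebra.Module.Rat
import Mathlib.Algebra.Algebra.Rat
import HarnessLib

/-!
# Tate 1967 §3.3 Theorem 2 over `ℚ_p(μ_{p^∞})`: a continuous `χ^j`-TWISTED cocycle of `Gal(F̄/ℚ_p)` in `ℂ_F`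
# (`j ≠ 0`) is a twisted coboundary — `H¹_cont(G₀, ℂ_F(χ^j)) = 0` GRANTED (TS1)

Companion of `TateH1Cocycle` (edix-p1: the UNtwisted line `H¹(G₀, ℂ_F) = ℚ_p · λ`) and of `TateSenCocycles` /
`TateSenConditionCompletedAlgClosure` (edix-p4: `H¹_cont(ker χ, ℂ_F) = 0` granted the Tate–Sen condition (TS1),
named fact `tate1967_TS1_completedAlgClosure`). Notation: `K₀ = PadicBase F p hp ≅ ℚ_p`, `G₀ = Gal(F̄/K₀)`,
`χ` its cyclotomic character, `W g = χ(g) ∈ K₀` (`TateDescent.W`), `ι : K₀ → ℂ_F` (`TateTrace.ι`),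
`H₀ = ker χ`, `X = \widehat{K₀(μ_{p^∞})}`, `γ = gen n`.

* `TwistedFiniteLayer.exists_eq_sub_of_forall_mem` — GENERIC: for any action `ρ : G →* AddMonoid.End M` of a
  group on a `ℚ`-vector space and any subgroup `N` of finite index, a `ρ`-cocycle (`c(gh) = c g + ρ g (c h)`)
  vanishing on `N` is a `ρ`-coboundary `c g = ρ g m − m` (averaging over `G/N`; the twisted analogue of
  `FiniteLayer.exists_eq_smul_sub_of_forall_fixingSubgroup`).
* `TateTwisted.exists_eq_twistedCoboundary` — **for `j ≠ 0`, every CONTINUOUS `χ^j`-twisted `1`-cocycle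
  `C : G₀ → ℂ_F`, `C(g g') = C g + ι(W g)^j · g • C g'`, is `ι(W g)^j · g • b − b`**, GRANTED
  `tate1967_TS1_completedAlgClosure` (displayed). This is exactly the hypothesis `hG` (with `ℓ = 0`) of
  `TateDescent.exists_eq_twistedCoboundary_of_base` (edix-p2, `TateCocycleTransferContinuous`), whence
  `H¹_cont(Γ_F, ℂ_F(χ_F^j)) = 0` for every `p`-adic field `F` and `j ≠ 0` (Tate 1967 §3.3 Thm. 2, `H¹` half).
  Proof: (1) on `H₀` the cocycle is untwisted; subtract the coboundary of `baseKer_exists_eq_smul_sub` ((TS1));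
  (2) the values of a twisted cocycle vanishing on `H₀` lie in `X` (`H₀ ⊴ G₀`, Ax–Sen–Tate `fixedPoints_eq_X`);
  (3) kill `C(γ)` with the unique `y ∈ X`, `ι(W γ)^j γ y − y = C γ` (`TateTrace.exists_unique_chi_zpow_mul_gen_smul_sub_eq`,
  `γ − c` bijective on `X`); (4) the cocycle then vanishes on `Gal(F̄/K n)` — Tate's continuity step by
  COMPACTNESS as in `TateH1.mul_apply_eq_mul_apply_gen_of_reduced` (nested closed sets
  `{u ∈ Gal(F̄/K M) | ‖C u‖ = ‖C g‖}` meet `H₀`); (5) finite layer `Gal(K n/K₀)` by the generic lemma.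

THEOREMS ONLY; no named fact, no definition, no `sorry`. NOT here: the untwisted `j = 0` case (`TateH1Cocycle`),
the transfer to `Γ_F` (one application of `TateDescent.exists_eq_twistedCoboundary_of_base`), (TS1) itself.

## References
* J. Tate, *p-divisible groups* (1967), §3.2 Prop. 7 (c), Prop. 8 (b), Prop. 10; §3.3 Theorem 2. [Tate1967]
* J.-M. Fontaine, Y. Ouyang, *Theory of p-adic Galois representations*, §3.2 Prop. 3.16–3.17, Thm. 3.21. [FontaineOuyang2022]
* J.-P. Serre, *Local Fields* (1979), Ch. VIII §2 Cor. 1 (finite groups: `H^q` killed by the order). [SerreLocalFields1979]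
-/

noncomputable section

open ValuativeRel Field UniformSpace Filter Topology Finset

open scoped IntermediateField

namespace Literature.NumberTheory.PAdicHodge

/-! ### Generic: a cocycle for an arbitrary action, trivial on a finite-index subgroup, is a coboundary -/

namespace TwistedFiniteLayer

/-- **`[G : N] < ∞` kills `H¹` with uniquely divisible coefficients, for ANY action.** Let `ρ : G →* End(M)`
be an action of the group `G` on the `ℚ`-vector space `M` by additive maps, `N ≤ G` a subgroup of finite index,
and `c : G → M` a `ρ`-cocycle (`c(gh) = c(g) + ρ(g)(c(h))`) vanishing on `N`. Then `c(g) = ρ(g)(m) − m` with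
`m = −[G:N]⁻¹ Σ_{q ∈ G/N} c(q.out)` (the cocycle is constant on left cosets; reindex `q ↦ g • q`).
[cite: SerreLocalFields1979, Ch. VIII §2 Cor. 1] -/
theorem exists_eq_sub_of_forall_mem {G M : Type*} [Group G] [AddCommGroup M] [Module ℚ M]
    (ρ : G →* AddMonoid.End M) (N : Subgroup G) [N.FiniteIndex]
    (c : G → M) (hc : ∀ g h : G, c (g * h) = c g + ρ g (c h)) (hN : ∀ u ∈ N, c u = 0) :
    ∃ m : M, ∀ g : G, c g = ρ g m - m := by
  classical
  haveI : Fintype (G ⧸ N) := Subgroup.fintypeQuotientOfFiniteIndex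
  -- `c` is constant on left cosets `gN`
  have hconst : ∀ (g : G) (u : G), u ∈ N → c (g * u) = c g := by
    intro g u hu
    rw [hc, hN u hu, map_zero, add_zero]
  set d : ℚ := (Fintype.card (G ⧸ N) : ℚ) with hd
  have hd0 : d ≠ 0 := by
    rw [hd, Nat.cast_ne_zero]
    exact Fintype.card_ne_zero
  refine ⟨-(d⁻¹ • ∑ q : G ⧸ N, c q.out), fun g => ?_⟩
  -- `ρ g (c q.out) = c ((g • q).out) - c g`
  have hq : ∀ q : G ⧸ N, ρ g (c q.out) = c (g • q).out - c g := by
    intro q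
    obtain ⟨u, hu⟩ : ∃ u : N, (g • q).out = g * q.out * u := by
      have h1 : g • q = (QuotientGroup.mk (g * q.out) : G ⧸ N) := by
        conv_lhs => rw [← QuotientGroup.out_eq' q]
        rfl
      rw [h1]
      exact QuotientGroup.mk_out_eq_mul N (g * q.out)
    have h2 := hc g q.out
    rw [hu, hconst _ _ u.2]
    rw [h2]
    abel
  have hre : ∑ q : G ⧸ N, c (g • q).out = ∑ q : G ⧸ N, c q.out :=
    Fintype.sum_equiv (MulAction.toPerm g) _ _ fun q => rfl
  rw [map_neg, map_rat_smul, map_sum, Finset.sum_congr rfl fun q _ => hq q, Finset.sum_sub_distrib, hre,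
    Finset.sum_const, Finset.card_univ]
  have hcancel : d⁻¹ • ((Fintype.card (G ⧸ N)) • c g) = c g := by
    rw [← Nat.cast_smul_eq_nsmul ℚ, smul_smul, ← hd, inv_mul_cancel₀ hd0, one_smul]
  rw [smul_sub, hcancel]
  abel

end TwistedFiniteLayer

/-! ### The twisted cocycles of `G₀` in `ℂ_F` -/

namespace TateTwisted

open Literature.NumberTheory.GaloisRepresentations
open Literature.NumberTheory.GaloisRepresentations.IsNonarchimedeanLocalField
open CyclotomicTower TateTrace

variable {F : Type} [Field F] [ValuativeRel F] [TopologicalSpace F] [IsNonarchimedeanLocalField F]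
  [CharZero F] {p : ℕ} [Fact p.Prime] (hp : valuation F p < 1) (j : ℤ)

/-- The twisting scalar `ε(g) = ι(W g)^j = χ(g)^j ∈ ℂ_F` is fixed by `G₀`. [cite: Tate1967, §3.3] -/
theorem smul_eps (g h : BaseGaloisGroup hp) : g • (ι hp (TateDescent.W hp h) ^ j) = ι hp (TateDescent.W hp h) ^ j := by
  change MulSemiringAction.toRingHom (BaseGaloisGroup hp) (CompletedAlgClosure F) g (ι hp (TateDescent.W hp h) ^ j) = _
  rw [map_zpow₀, MulSemiringAction.toRingHom_apply, base_smul_ι]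

/-- `ε(gh) = ε(g) ε(h)`. [folklore] -/
private theorem eps_mul (g h : BaseGaloisGroup hp) :
    ι hp (TateDescent.W hp (g * h)) ^ j = ι hp (TateDescent.W hp g) ^ j * ι hp (TateDescent.W hp h) ^ j := by
  rw [map_mul, ← ιHom_apply, map_mul, mul_zpow, ιHom_apply, ιHom_apply]

/-- `‖ε(g)‖ = 1`. [folklore] -/
private theorem norm_eps (g : BaseGaloisGroup hp) : ‖ι hp (TateDescent.W hp g) ^ j‖ = 1 := by
  rw [norm_zpow, norm_ι, TateDescent.W_apply, PadicBase.norm_ofPadicInt_units, one_zpow]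

/-- `ε(h) = 1` on `H₀ = ker χ`. [folklore] -/
private theorem eps_eq_one_of_mem {h : BaseGaloisGroup hp} (hh : h ∈ (BaseGaloisGroup.baseCyclotomicCharacter hp).ker) :
    ι hp (TateDescent.W hp h) ^ j = 1 := by
  rw [MonoidHom.mem_ker] at hh
  rw [TateDescent.W_apply, hh, Units.val_one, map_one, ← ιHom_apply, map_one, one_zpow]

/-- The twisted action `ρ_j(g)(x) = ε(g) · g • x` as a homomorphism `G₀ →* End(ℂ_F)`; we only use it through
the generic finite-layer lemma, so it is built inside proofs. Here: its multiplicativity. [cite: Tate1967, §3.3] -/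
theorem twist_mul (g h : BaseGaloisGroup hp) (x : CompletedAlgClosure F) :
    ι hp (TateDescent.W hp (g * h)) ^ j * ((g * h) • x) =
      ι hp (TateDescent.W hp g) ^ j * (g • (ι hp (TateDescent.W hp h) ^ j * (h • x))) := by
  rw [eps_mul, smul_mul', smul_eps, mul_smul, mul_assoc]

variable {j}

/-- A twisted cocycle vanishes at `1`. [folklore] -/
private theorem apply_one {C : BaseGaloisGroup hp → CompletedAlgClosure F}
    (hC : ∀ g g' : BaseGaloisGroup hp, C (g * g') = C g + ι hp (TateDescent.W hp g) ^ j * (g • C g')) : C 1 = 0 := by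
  have h := hC 1 1
  rw [one_mul, one_smul, map_one, ← ιHom_apply, map_one, one_zpow, one_mul] at h
  exact left_eq_add.mp h

/-- Subtracting a twisted coboundary `g ↦ ε(g) · g • b − b` from a twisted cocycle gives a twisted cocycle.
[folklore] -/
private theorem cocycle_sub_twistedCoboundary {C : BaseGaloisGroup hp → CompletedAlgClosure F}
    (hC : ∀ g g' : BaseGaloisGroup hp, C (g * g') = C g + ι hp (TateDescent.W hp g) ^ j * (g • C g'))
    (b : CompletedAlgClosure F) :
    ∀ g g' : BaseGaloisGroup hp,
      (C (g * g') - (ι hp (TateDescent.W hp (g * g')) ^ j * ((g * g') • b) - b)) =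
        (C g - (ι hp (TateDescent.W hp g) ^ j * (g • b) - b)) +
          ι hp (TateDescent.W hp g) ^ j * (g • (C g' - (ι hp (TateDescent.W hp g') ^ j * (g' • b) - b))) := by
  intro g g'
  rw [hC g g', twist_mul hp j g g' b, smul_sub, smul_sub, mul_sub, mul_sub]
  abel

/-- A twisted coboundary `g ↦ ε(g) · g • b − b` is continuous on `G₀`. [folklore] -/
private theorem continuous_twistedCoboundary (b : CompletedAlgClosure F) :
    Continuous fun g : BaseGaloisGroup hp => ι hp (TateDescent.W hp g) ^ j * (g • b) - b := by
  have hι : Continuous (ι hp) := (AddMonoidHomClass.isometry_of_norm (ιHom hp) (norm_ι hp)).continuous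
  have hW : Continuous (TateDescent.W hp) := by
    have h1 : Continuous fun g : BaseGaloisGroup hp =>
        (((BaseGaloisGroup.baseCyclotomicCharacter hp g : ℤ_[p]ˣ) : ℤ_[p]) : ℚ_[p]) :=
      (continuous_subtype_val : Continuous ((↑) : ℤ_[p] → ℚ_[p])).comp
        ((Units.continuous_val : Continuous (fun u : ℤ_[p]ˣ => (u : ℤ_[p]))).comp
          (cyclotomicCharacter.continuous p (PadicBase F p hp) (NormedAlgClosure F)))
    have h2 : (TateDescent.W hp : BaseGaloisGroup hp → PadicBase F p hp) = fun g =>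
        (PadicBase.toPadic hp).symm (((BaseGaloisGroup.baseCyclotomicCharacter hp g : ℤ_[p]ˣ) : ℤ_[p]) : ℚ_[p]) := by
      funext g; rw [TateDescent.W_apply, PadicBase.ofPadicInt_apply]
    rw [h2]
    exact (TateSen.continuous_toPadic_symm hp).comp h1
  have hne : ∀ g : BaseGaloisGroup hp, (ι hp ∘ TateDescent.W hp) g ≠ 0 := by
    intro g
    rw [Function.comp_apply, Ne, ← norm_eq_zero, norm_ι, TateDescent.W_apply, PadicBase.norm_ofPadicInt_units]
    exact one_ne_zero
  have hε : Continuous fun g : BaseGaloisGroup hp => ι hp (TateDescent.W hp g) ^ j :=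
    (hι.comp hW).zpow₀ j fun g => Or.inl (hne g)
  exact (hε.mul (TateSen.continuous_base_smul_left hp b)).sub continuous_const

/-- **The values of a twisted cocycle vanishing on `H₀ = ker χ` are `H₀`-fixed, hence lie in `X`** (`H₀ ⊴ G₀`;
Ax–Sen–Tate `fixedPoints_eq_X`). [cite: Tate1967, §3.3] -/
theorem mem_X_of_forall_mem_ker {C : BaseGaloisGroup hp → CompletedAlgClosure F}
    (hC : ∀ g g' : BaseGaloisGroup hp, C (g * g') = C g + ι hp (TateDescent.W hp g) ^ j * (g • C g'))
    (hH : ∀ h ∈ (BaseGaloisGroup.baseCyclotomicCharacter hp).ker, C h = 0) (g : BaseGaloisGroup hp) :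
    C g ∈ X hp := by
  rw [← fixedPoints_eq_X hp]
  intro h hh
  have hhk : h ∈ (BaseGaloisGroup.baseCyclotomicCharacter hp).ker :=
    (TateSen.mem_baseKer_iff_forall_smul_zeta hp h).mpr hh
  -- `C(h g) = h • C g` and `C(h g) = C(g (g⁻¹ h g)) = C g`
  have h1 : C (h * g) = h • C g := by
    rw [hC, hH h hhk, eps_eq_one_of_mem hp j hhk, zero_add, one_mul]
  have hconj : g⁻¹ * h * g ∈ (BaseGaloisGroup.baseCyclotomicCharacter hp).ker := by
    have := (MonoidHom.normal_ker (BaseGaloisGroup.baseCyclotomicCharacter hp)).conj_mem h hhk g⁻¹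
    rwa [inv_inv] at this
  have h2 : C (h * g) = C g := by
    have : h * g = g * (g⁻¹ * h * g) := by group
    rw [this, hC, hH _ hconj, smul_zero, mul_zero, add_zero]
  rw [← h1, h2]

/-- Fixing `ζ_{p^{M'}}` implies fixing `ζ_{p^M}` for `M ≤ M'`. [folklore] -/
private theorem smul_zeta_eq_of_le {M M' : ℕ} (h : M ≤ M') {u : BaseGaloisGroup hp}
    (hu : u • zeta F p M' = zeta F p M') : u • zeta F p M = zeta F p M := by
  obtain ⟨i, hi⟩ := exists_zeta_eq_pow (F := F) (p := p) h
  rw [hi, smul_pow', hu]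

/-- **Tate's continuity step, twisted form, by compactness.** A continuous twisted cocycle `C` vanishing on `H₀`
and at `γ = gen n` (`n ≥ 2`) vanishes on `Gal(F̄/K n)`: for `g` fixing `ζ_{pⁿ}` and every `M > n` there is `k`
with `u_M = (γ^k)⁻¹ g ∈ Gal(F̄/K M)`, and `‖C(u_M)‖ = ‖C(g)‖` (`C(γ^{±k}) = 0`, the twist is a unit, the action
is isometric); the nested closed sets `{u ∈ Gal(F̄/K M) : ‖C u‖ = ‖C g‖}` of the compact `G₀` meet in a point
of `H₀`, where `C = 0`. [cite: Tate1967, §3.3 Theorem 2] [cite: FontaineOuyang2022, §3.2 Prop. 3.17] -/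
theorem eq_zero_of_smul_zeta_eq {n : ℕ} (hn : 2 ≤ n) {C : BaseGaloisGroup hp → CompletedAlgClosure F}
    (hC : ∀ g g' : BaseGaloisGroup hp, C (g * g') = C g + ι hp (TateDescent.W hp g) ^ j * (g • C g'))
    (hH : ∀ h ∈ (BaseGaloisGroup.baseCyclotomicCharacter hp).ker, C h = 0) (hcont : Continuous C)
    (hγ : C (gen hp n) = 0) {g : BaseGaloisGroup hp} (hg : g • zeta F p n = zeta F p n) : C g = 0 := by
  haveI : IsGalois (PadicBase F p hp) (NormedAlgClosure F) := inferInstance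
  set γ := gen hp n with hγdef
  -- `C(γ^k) = 0` and `C((γ^k)⁻¹) = 0`
  have hpow : ∀ k : ℕ, C (γ ^ k) = 0 := by
    intro k
    induction k with
    | zero => rw [pow_zero]; exact apply_one hp hC
    | succ k ih => rw [pow_succ, hC, ih, hγ, smul_zero, mul_zero, add_zero]
  have hinv : ∀ k : ℕ, C ((γ ^ k)⁻¹) = 0 := by
    intro k
    have h := hC ((γ ^ k)⁻¹) (γ ^ k)
    rw [inv_mul_cancel, apply_one hp hC, hpow k, smul_zero, mul_zero, add_zero] at h
    exact h.symm
  -- `‖C((γ^k)⁻¹ g)‖ = ‖C g‖`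
  have hnorm : ∀ k : ℕ, ‖C ((γ ^ k)⁻¹ * g)‖ = ‖C g‖ := by
    intro k
    rw [hC, hinv k, zero_add, norm_mul, norm_eps, one_mul, CompletedAlgClosure.norm_base_smul]
  -- the nested closed sets
  have hDcont : Continuous fun u : BaseGaloisGroup hp => ‖C u‖ := continuous_norm.comp hcont
  set S : ℕ → Set (BaseGaloisGroup hp) := fun t =>
    {u | u • zeta F p (n + 1 + t) = zeta F p (n + 1 + t)} ∩ {u | ‖C u‖ = ‖C g‖} with hS
  have hSne : ∀ t, (S t).Nonempty := by
    intro t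
    obtain ⟨k, hk⟩ := exists_pow_gen_smul_eq_of_smul_zeta_eq hp hn (M := n + 1 + t) (by omega) hg
    refine ⟨(γ ^ k)⁻¹ * g, ?_, hnorm k⟩
    change ((γ ^ k)⁻¹ * g) • zeta F p (n + 1 + t) = zeta F p (n + 1 + t)
    rw [mul_smul, hk _ (zeta_mem_K hp _), inv_smul_smul]
  have hScl : ∀ t, IsClosed (S t) := fun t =>
    (TateH1.isClosed_setOf_smul_zeta_eq hp _).inter (isClosed_eq hDcont continuous_const)
  have hSdir : Directed (· ⊇ ·) S := by
    refine Antitone.directed_ge fun t t' htt' u hu => ⟨?_, hu.2⟩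
    exact smul_zeta_eq_of_le hp (by omega) hu.1
  obtain ⟨u, hu⟩ := IsCompact.nonempty_iInter_of_directed_nonempty_isCompact_isClosed S hSdir hSne
    (fun t => (hScl t).isCompact) hScl
  rw [Set.mem_iInter] at hu
  have huH : u ∈ (BaseGaloisGroup.baseCyclotomicCharacter hp).ker :=
    (TateSen.mem_baseKer_iff_forall_smul_zeta hp u).mpr fun M =>
      smul_zeta_eq_of_le hp (show M ≤ n + 1 + M by omega) (hu M).1
  have h0 : ‖C g‖ = 0 := by rw [← (hu 0).2, hH u huH, norm_zero]
  exact norm_eq_zero.mp h0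

/-- **Tate 1967 §3.3 Theorem 2 (`H¹` half) over the base tower, GRANTED (TS1): for `j ≠ 0` every continuous
`χ^j`-twisted `1`-cocycle of `G₀ = Gal(F̄/ℚ_p)` in `ℂ_F` is a twisted coboundary.** For
`C : G₀ → ℂ_F` continuous with `C(g g') = C(g) + ι(W g)^j · g • C(g')` there is `b ∈ ℂ_F` with
`C(g) = ι(W g)^j · g • b − b` for all `g` — granted the named fact `tate1967_TS1_completedAlgClosure`
(Tate's almost étale lemma, displayed). Steps: restriction to `H₀ = ker χ` and `baseKer_exists_eq_smul_sub`
((TS1)); values in `X`; `TateTrace.exists_unique_chi_zpow_mul_gen_smul_sub_eq` at `γ = gen 3`; the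
compactness step `eq_zero_of_smul_zeta_eq`; the finite layer `Gal(K 3/K₀)` by
`TwistedFiniteLayer.exists_eq_sub_of_forall_mem`. This is the hypothesis `hG` (with `ℓ = 0`) of
`TateDescent.exists_eq_twistedCoboundary_of_base`, which transfers it to every `Γ_F`.
[cite: Tate1967, §3.3 Theorem 2] [cite: FontaineOuyang2022, §3.2 Thm. 3.21] -/
theorem exists_eq_twistedCoboundary (hTS1 : tate1967_TS1_completedAlgClosure) (hj : j ≠ 0)
    (C : BaseGaloisGroup hp → CompletedAlgClosure F)
    (hC : ∀ g g' : BaseGaloisGroup hp, C (g * g') = C g + ι hp (TateDescent.W hp g) ^ j * (g • C g'))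
    (hcont : Continuous C) :
    ∃ b : CompletedAlgClosure F, ∀ g : BaseGaloisGroup hp, C g = ι hp (TateDescent.W hp g) ^ j * (g • b) - b := by
  classical
  haveI : IsGalois (PadicBase F p hp) (NormedAlgClosure F) := inferInstance
  haveI : CharZero (CompletedAlgClosure F) :=
    charZero_of_injective_algebraMap (algebraMap F (CompletedAlgClosure F)).injective
  set H₀ : Subgroup (BaseGaloisGroup hp) := (BaseGaloisGroup.baseCyclotomicCharacter hp).ker with hH₀
  -- Step 1: on `H₀` the cocycle is untwisted; (TS1) trivialises it there
  obtain ⟨b₀, hb₀⟩ : ∃ b₀ : CompletedAlgClosure F, ∀ h : H₀, C h = h • b₀ - b₀ := by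
    refine baseKer_exists_eq_smul_sub hTS1 hp (fun h : H₀ => C h) (fun h h' => ?_)
      (hcont.comp continuous_subtype_val)
    change C ((h : BaseGaloisGroup hp) * h') = C h + (h : BaseGaloisGroup hp) • C h'
    rw [hC, eps_eq_one_of_mem hp j h.2, one_mul]
  set C₁ : BaseGaloisGroup hp → CompletedAlgClosure F :=
    fun g => C g - (ι hp (TateDescent.W hp g) ^ j * (g • b₀) - b₀) with hC₁
  have hC₁coc : ∀ g g' : BaseGaloisGroup hp, C₁ (g * g') = C₁ g + ι hp (TateDescent.W hp g) ^ j * (g • C₁ g') :=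
    cocycle_sub_twistedCoboundary hp hC b₀
  have hC₁cont : Continuous C₁ := hcont.sub (continuous_twistedCoboundary hp b₀)
  have hC₁H : ∀ h ∈ H₀, C₁ h = 0 := by
    intro h hh
    simp only [hC₁]
    rw [hb₀ ⟨h, hh⟩, eps_eq_one_of_mem hp j hh, one_mul]
    exact sub_self _
  -- Step 2/3: values in `X`; kill `C₁ γ`, `γ = gen 3`
  have ha : C₁ (gen hp 3) ∈ X hp := mem_X_of_forall_mem_ker hp hC₁coc hC₁H _
  obtain ⟨y, ⟨hyX, hy⟩, -⟩ := exists_unique_chi_zpow_mul_gen_smul_sub_eq hp (n := 3) le_rfl hj ha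
  rw [← TateDescent.W_apply] at hy
  set C₂ : BaseGaloisGroup hp → CompletedAlgClosure F :=
    fun g => C₁ g - (ι hp (TateDescent.W hp g) ^ j * (g • y) - y) with hC₂
  have hC₂coc : ∀ g g' : BaseGaloisGroup hp, C₂ (g * g') = C₂ g + ι hp (TateDescent.W hp g) ^ j * (g • C₂ g') :=
    cocycle_sub_twistedCoboundary hp hC₁coc y
  have hC₂cont : Continuous C₂ := hC₁cont.sub (continuous_twistedCoboundary hp y)
  have hyfix : ∀ h ∈ H₀, h • y = y := by
    intro h hh
    have hy' : y ∈ {x : CompletedAlgClosure F |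
        ∀ g : BaseGaloisGroup hp, (∀ M, g • zeta F p M = zeta F p M) → g • x = x} := by
      rw [fixedPoints_eq_X hp]; exact hyX
    exact hy' h ((TateSen.mem_baseKer_iff_forall_smul_zeta hp h).mp hh)
  have hC₂H : ∀ h ∈ H₀, C₂ h = 0 := by
    intro h hh
    simp only [hC₂]
    rw [hC₁H h hh, hyfix h hh, eps_eq_one_of_mem hp j hh, one_mul, sub_self, sub_zero]
  have hC₂γ : C₂ (gen hp 3) = 0 := by
    simp only [hC₂]
    rw [hy]
    exact sub_self _
  -- Step 4: `C₂` vanishes on `Gal(F̄/K 3)`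
  have hC₂van : ∀ g : BaseGaloisGroup hp, g ∈ (K hp 3).fixingSubgroup → C₂ g = 0 := by
    intro g hg
    have hg' : g • zeta F p 3 = zeta F p 3 := by
      have : g ∈ {u : BaseGaloisGroup hp | u • zeta F p 3 = zeta F p 3} := by
        rw [TateH1.setOf_smul_zeta_eq hp 3]; exact hg
      exact this
    exact eq_zero_of_smul_zeta_eq hp (by norm_num) hC₂coc hC₂H hC₂cont hC₂γ hg'
  -- Step 5: the finite layer `Gal(K 3/K₀)`, by the generic lemma for the twisted action
  haveI : FiniteDimensional (PadicBase F p hp) (K hp 3) :=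
    IntermediateField.adjoin.finiteDimensional (Algebra.IsIntegral.isIntegral (zeta F p 3))
  haveI : Finite (BaseGaloisGroup hp ⧸ (K hp 3).fixingSubgroup) :=
    Subgroup.quotient_finite_of_isOpen _ (K hp 3).fixingSubgroup_isOpen
  haveI : ((K hp 3).fixingSubgroup).FiniteIndex := Subgroup.finiteIndex_of_finite_quotient
  let ρ : BaseGaloisGroup hp →* AddMonoid.End (CompletedAlgClosure F) :=
    { toFun := fun g => (AddMonoidHom.mulLeft (ι hp (TateDescent.W hp g) ^ j)).comp
        (DistribSMul.toAddMonoidHom (CompletedAlgClosure F) g)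
      map_one' := by
        ext x
        change ι hp (TateDescent.W hp 1) ^ j * ((1 : BaseGaloisGroup hp) • x) = x
        rw [map_one, ← ιHom_apply, map_one, one_zpow, one_mul, one_smul]
      map_mul' := fun g h => by
        ext x
        exact twist_mul hp j g h x }
  have hρ : ∀ (g : BaseGaloisGroup hp) (x : CompletedAlgClosure F), ρ g x = ι hp (TateDescent.W hp g) ^ j * (g • x) :=
    fun g x => rfl
  obtain ⟨m, hm⟩ := TwistedFiniteLayer.exists_eq_sub_of_forall_mem ρ (K hp 3).fixingSubgroup C₂
    (fun g h => by rw [hρ]; exact hC₂coc g h) hC₂van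
  -- Step 6: assemble
  refine ⟨m + y + b₀, fun g => ?_⟩
  have h1 : C g = C₂ g + (ι hp (TateDescent.W hp g) ^ j * (g • y) - y) +
      (ι hp (TateDescent.W hp g) ^ j * (g • b₀) - b₀) := by
    simp only [hC₂, hC₁]; abel
  rw [h1, hm g, hρ, smul_add, smul_add, mul_add, mul_add]
  abel

/-! ### Over `F`: `H¹_cont(Γ_F, ℂ_F(χ_F^j)) = 0` for `j ≠ 0` (transfer `G₀ ⇝ Γ_F`, edix-p2's b5) -/

/-- The twisting scalar at `toBase σ` is the image of `χ_F(σ)` under `ℤ_p ⊆ ℚ_p → F → ℂ_F`. [folklore] -/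
private theorem eps_toBase (σ : absoluteGaloisGroup F) :
    ι hp (TateDescent.W hp (BaseGaloisGroup.toBase hp σ)) =
      algebraMap F (CompletedAlgClosure F)
        (LocalField.padicRingHom F p hp (((GaloisRep.cyclotomicCharacter F p σ : ℤ_[p]ˣ) : ℤ_[p]) : ℚ_[p])) := by
  rw [TateDescent.W_apply, BaseGaloisGroup.baseCyclotomicCharacter_toBase]
  rfl

/-- **Tate 1967 §3.3 Theorem 2 (`H¹` half) for the `p`-adic field `F`, GRANTED (TS1): `H¹_cont(Γ_F, ℂ_F(χ_F^j)) = 0`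
for `j ≠ 0`.** Every continuous `1`-cocycle `c : Γ_F → ℂ_F` for the `χ_F^j`-twisted action
(`c(στ) = c(σ) + χ_F(σ)^j · σ • c(τ)`, the scalar `χ_F(σ)^j` through `ℤ_p ⊆ ℚ_p → F → ℂ_F`) is a twisted
coboundary `c(σ) = χ_F(σ)^j · σ • B − B` — by the transfer `TateDescent.exists_eq_twistedCoboundary_of_base`
(with `ℓ = 0`) applied to `exists_eq_twistedCoboundary`. CONDITIONAL on the named fact
`tate1967_TS1_completedAlgClosure` (displayed). [cite: Tate1967, §3.3 Theorem 2] [cite: FontaineOuyang2022, §3.2 Thm. 3.21] -/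
theorem absGalois_exists_eq_twistedCoboundary (hTS1 : tate1967_TS1_completedAlgClosure) (hj : j ≠ 0)
    {c : absoluteGaloisGroup F → CompletedAlgClosure F}
    (hc : ∀ σ τ : absoluteGaloisGroup F, c (σ * τ) = c σ +
      (algebraMap F (CompletedAlgClosure F)
        (LocalField.padicRingHom F p hp
          (((GaloisRep.cyclotomicCharacter F p σ : ℤ_[p]ˣ) : ℤ_[p]) : ℚ_[p]))) ^ j * (σ • c τ))
    (hcont : Continuous c) :
    ∃ B : CompletedAlgClosure F, ∀ σ : absoluteGaloisGroup F, c σ =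
      (algebraMap F (CompletedAlgClosure F)
        (LocalField.padicRingHom F p hp
          (((GaloisRep.cyclotomicCharacter F p σ : ℤ_[p]ˣ) : ℤ_[p]) : ℚ_[p]))) ^ j * (σ • B) - B := by
  have hc' : ∀ σ τ : absoluteGaloisGroup F, c (σ * τ) =
      c σ + ι hp (TateDescent.W hp (BaseGaloisGroup.toBase hp σ)) ^ j * (σ • c τ) := by
    intro σ τ; rw [eps_toBase]; exact hc σ τ
  obtain ⟨B, A, hB⟩ := TateDescent.exists_eq_twistedCoboundary_of_base hp j (fun _ => 0)
    (fun C hC hCc => by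
      obtain ⟨b, hb⟩ := exists_eq_twistedCoboundary hp hTS1 hj C hC hCc
      exact ⟨b, 0, fun g => by rw [hb g, mul_zero, add_zero]⟩)
    hc' hcont
  refine ⟨B, fun σ => ?_⟩
  rw [hB σ, mul_zero, add_zero, eps_toBase]

end TateTwisted

/-! ### Over `F`, `j = 0`: `H¹_cont(Γ_F, ℂ_F) = F · [log χ_F]` granted (TS1) (Tate 1967 §3.3 Theorem 1) -/

namespace TateH1OverF

open Literature.NumberTheory.GaloisRepresentations
open Literature.NumberTheory.GaloisRepresentations.IsNonarchimedeanLocalField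
open CyclotomicTower TateTrace

variable {F : Type} [Field F] [ValuativeRel F] [TopologicalSpace F] [IsNonarchimedeanLocalField F]
  [CharZero F] {p : ℕ} [Fact p.Prime] (hp : valuation F p < 1)

/-- The named fact (TS1) (general pairs, systems of representatives) yields the special form «every open
`U ≤ H₀ = ker χ` has a `U`-invariant `α`, `‖α‖ ≤ K`, `Σ_{q ∈ H₀/U} q.out • α = 1`» displayed by
`TateSen.baseKer_exists_eq_smul_sub_of_TS1` / `TateH1.exists_eq_mul_logChi_add_coboundary_of_TS1`
(take `H₂ = H₀` and the representatives `q ↦ q.out`). [cite: BergerColmez2008, Déf. 3.1.3 (TS1) and Prop. 4.1.1] -/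
theorem TS1_baseKer_of_fact (hTS1 : tate1967_TS1_completedAlgClosure) :
    ∃ K : ℝ, ∀ U : OpenSubgroup (BaseGaloisGroup.baseCyclotomicCharacter hp).ker, ∃ α : CompletedAlgClosure F,
      (∀ u ∈ U, u • α = α) ∧ ‖α‖ ≤ K ∧
        ∑ᶠ q : (BaseGaloisGroup.baseCyclotomicCharacter hp).ker ⧸ U.toSubgroup, q.out • α = 1 := by
  classical
  haveI : IsGalois (PadicBase F p hp) (NormedAlgClosure F) := inferInstance
  have hcl : IsClosed (((BaseGaloisGroup.baseCyclotomicCharacter hp).ker :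
      Subgroup (BaseGaloisGroup hp)) : Set (BaseGaloisGroup hp)) := by
    have h : (((BaseGaloisGroup.baseCyclotomicCharacter hp).ker : Subgroup (BaseGaloisGroup hp)) :
        Set (BaseGaloisGroup hp)) = (BaseGaloisGroup.baseCyclotomicCharacter hp) ⁻¹' {1} := by
      ext g
      exact MonoidHom.mem_ker
    rw [h]
    exact isClosed_singleton.preimage
      (cyclotomicCharacter.continuous p (PadicBase F p hp) (NormedAlgClosure F))
  haveI : CompactSpace (BaseGaloisGroup.baseCyclotomicCharacter hp).ker :=
    isCompact_iff_compactSpace.mp hcl.isCompact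
  obtain ⟨K, hK⟩ := hTS1 hp
  refine ⟨K, fun U => ?_⟩
  haveI : Fintype ((BaseGaloisGroup.baseCyclotomicCharacter hp).ker ⧸ U.toSubgroup) := Fintype.ofFinite _
  set S : Finset (BaseGaloisGroup.baseCyclotomicCharacter hp).ker :=
    Finset.univ.image (fun q : (BaseGaloisGroup.baseCyclotomicCharacter hp).ker ⧸ U.toSubgroup => q.out)
    with hS
  have hrep : ∀ h ∈ (⊤ : OpenSubgroup (BaseGaloisGroup.baseCyclotomicCharacter hp).ker),
      ∃! s, s ∈ S ∧ s⁻¹ * h ∈ U := by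
    intro h _
    refine ⟨(QuotientGroup.mk h : _ ⧸ U.toSubgroup).out, ⟨?_, ?_⟩, ?_⟩
    · exact Finset.mem_image.mpr ⟨QuotientGroup.mk h, Finset.mem_univ _, rfl⟩
    · exact QuotientGroup.eq.mp (QuotientGroup.out_eq' (QuotientGroup.mk h : _ ⧸ U.toSubgroup))
    · rintro s ⟨hs, hsU⟩
      obtain ⟨q, -, rfl⟩ := Finset.mem_image.mp hs
      have hq : (QuotientGroup.mk q.out : _ ⧸ U.toSubgroup) = QuotientGroup.mk h := QuotientGroup.eq.mpr hsU
      rw [QuotientGroup.out_eq'] at hq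
      rw [hq]
  obtain ⟨α, hαU, hαK, hαS⟩ := hK U ⊤ le_top S (fun s _ => trivial) hrep
  refine ⟨α, hαU, hαK, ?_⟩
  rw [finsum_eq_sum_of_fintype, ← hαS, hS, Finset.sum_image]
  intro q₁ _ q₂ _ h
  exact Quotient.out_injective h

/-- `ι` of the `K₀`-valued `log χ` at `toBase σ` is `log χ_F(σ)` through `ℚ_p → F → ℂ_F`. [folklore] -/
private theorem ι_logChi_toBase (σ : absoluteGaloisGroup F) :
    ι hp ((PadicBase.toPadic hp).symm (Literature.IUT.LogVolume.unitLog
      (((BaseGaloisGroup.baseCyclotomicCharacter hp (BaseGaloisGroup.toBase hp σ) : ℤ_[p]ˣ) : ℤ_[p]) : ℚ_[p]))) =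
      algebraMap F (CompletedAlgClosure F) (LocalField.padicRingHom F p hp (logCyclotomic p σ)) := by
  rw [BaseGaloisGroup.baseCyclotomicCharacter_toBase]
  rfl

/-- **Tate 1967 §3.3 Theorem 1 (`H¹` half) for the `p`-adic field `F`, GRANTED (TS1): every continuous
`1`-cocycle of `Γ_F` in `ℂ_F` is `A · log χ_F + ∂B` with `A ∈ F`.** For `c : Γ_F → ℂ_F` continuous with
`c(στ) = c(σ) + σ • c(τ)` there are `B ∈ ℂ_F` and `A ∈ F` with
`c(σ) = σ • B − B + A · log χ_F(σ)` (`log χ_F = logCyclotomic p`, through `ℚ_p → F → ℂ_F`). Proof: edix-p1's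
`TateH1.exists_eq_mul_logChi_add_coboundary_of_TS1` over the base tower (itself via (TS1) through
`TateSen.baseKer_exists_eq_smul_sub_of_TS1`) transferred to `Γ_F` by edix-p2's
`TateDescent.exists_eq_twistedCoboundary_of_base` at `j = 0`. With the tree's
`CompletedAlgClosure.not_exists_smul_eq_add_mul_logCyclotomic` (`A · [log χ_F] ≠ 0` for `A ≠ 0`) this is
`H¹_cont(Γ_F, ℂ_F) = F · [log χ_F] ≅ F`. CONDITIONAL on the named fact `tate1967_TS1_completedAlgClosure` (displayed).
[cite: Tate1967, §3.3 Theorem 1] [cite: FontaineOuyang2022, §3.2 Thm. 3.21] -/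
theorem absGalois_exists_eq_coboundary_add_mul_logCyclotomic (hTS1 : tate1967_TS1_completedAlgClosure)
    {c : absoluteGaloisGroup F → CompletedAlgClosure F}
    (hc : ∀ σ τ : absoluteGaloisGroup F, c (σ * τ) = c σ + σ • c τ) (hcont : Continuous c) :
    ∃ (B : CompletedAlgClosure F) (A : F), ∀ σ : absoluteGaloisGroup F,
      c σ = σ • B - B + algebraMap F (CompletedAlgClosure F) A *
        algebraMap F (CompletedAlgClosure F) (LocalField.padicRingHom F p hp (logCyclotomic p σ)) := by
  -- the ℂ_F-valued `log χ` on `G₀`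
  set ℓ : BaseGaloisGroup hp → CompletedAlgClosure F := fun g =>
    ι hp ((PadicBase.toPadic hp).symm (Literature.IUT.LogVolume.unitLog
      (((BaseGaloisGroup.baseCyclotomicCharacter hp g : ℤ_[p]ˣ) : ℤ_[p]) : ℚ_[p]))) with hℓ
  have hG : ∀ C : BaseGaloisGroup hp → CompletedAlgClosure F,
      (∀ g g' : BaseGaloisGroup hp, C (g * g') = C g + ι hp (TateDescent.W hp g) ^ (0 : ℤ) * (g • C g')) →
      Continuous C →
        ∃ (b : CompletedAlgClosure F) (a : PadicBase F p hp), ∀ g : BaseGaloisGroup hp,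
          C g = ι hp (TateDescent.W hp g) ^ (0 : ℤ) * (g • b) - b + ι hp a * ℓ g := by
    intro C hC hCc
    have hC' : ∀ g g' : BaseGaloisGroup hp, C (g * g') = C g + g • C g' := fun g g' => by
      rw [hC, zpow_zero, one_mul]
    obtain ⟨a, b, hab⟩ := TateH1.exists_eq_mul_logChi_add_coboundary_of_TS1 hp (TS1_baseKer_of_fact hp hTS1) hC' hCc
    refine ⟨b, a, fun g => ?_⟩
    rw [hab g, zpow_zero, one_mul]
    simp only [hℓ]
    rw [← ιHom_apply, ← ιHom_apply, ← ιHom_apply, map_mul]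
    abel
  have hc' : ∀ σ τ : absoluteGaloisGroup F, c (σ * τ) =
      c σ + ι hp (TateDescent.W hp (BaseGaloisGroup.toBase hp σ)) ^ (0 : ℤ) * (σ • c τ) := fun σ τ => by
    rw [zpow_zero, one_mul]; exact hc σ τ
  obtain ⟨B, A, hB⟩ := TateDescent.exists_eq_twistedCoboundary_of_base hp 0 ℓ hG hc' hcont
  refine ⟨B, A, fun σ => ?_⟩
  rw [hB σ, zpow_zero, one_mul]
  simp only [hℓ]
  rw [ι_logChi_toBase]

/-- **Uniqueness of the coefficient**: in `c = ∂B + A · log χ_F` the scalar `A ∈ F` is unique (the class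
`[log χ_F]` spans a LINE: tree `CompletedAlgClosure.not_exists_smul_eq_add_mul_logCyclotomic`). Unconditional.
[cite: Tate1967, §3.3 Theorem 1] -/
theorem coeff_unique {B B' : CompletedAlgClosure F} {A A' : F}
    (h : ∀ σ : absoluteGaloisGroup F,
      σ • B - B + algebraMap F (CompletedAlgClosure F) A *
          algebraMap F (CompletedAlgClosure F) (LocalField.padicRingHom F p hp (logCyclotomic p σ)) =
        σ • B' - B' + algebraMap F (CompletedAlgClosure F) A' *
          algebraMap F (CompletedAlgClosure F) (LocalField.padicRingHom F p hp (logCyclotomic p σ))) :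
    A = A' := by
  by_contra hne
  have ha : A - A' ≠ 0 := sub_ne_zero.mpr hne
  refine CompletedAlgClosure.not_exists_smul_eq_add_mul_logCyclotomic hp ha ⟨B' - B, fun σ => ?_⟩
  have h1 := h σ
  rw [map_sub, smul_sub]
  linear_combination (-1 : CompletedAlgClosure F) * h1

end TateH1OverF

end Literature.NumberTheory.PAdicHodge

end
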